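import Literature.Geometry.Riemannian.ChernTransgressionPointwise
import Literature.Geometry.Riemannian.EulerFormFour
import Mathlib.LinearAlgebra.Matrix.Basis
import Mathlib.LinearAlgebra.Matrix.Adjugate
import HarnessLib

/-!
# Chern's transgression vector and the Pfaffian read in a frame of an abstract vector space

Companion of `ChernTransgressionPointwise.lean` (the pointwise algebra of Chern's transgression
form in dimension four: the Chern vector `chernVec g u♭ W N` of coordinate data and its
tensoriality `chernVec_basisChange`; the Pfaffian pairing `pfaffPair` and `pfaffPair_conj`).
There the data are ARRAYS; here they are read off from INTRINSIC objects on a real vector space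
`V` (a bilinear form `B` — the metric at a point —, a vector `u` — the unit field —, an
endomorphism `S` — the covariant differential `∇u` —, and a trilinear map `R` — the curvature
endomorphism `R(X, Y)Z`) in a basis `e : Fin 4 → V`:

* `frameGram B e`, `frameCovector B u e`, `frameEndo B S e`, `frameCurv B R e` — the arrays
  `g_{ij} = B(eᵢ, eⱼ)`, `u♭_a = B(u, e_a)`, `N_{ak} = B(S e_k, e_a)`,
  `W_{ackl} = B(R(e_k, e_l) e_c, e_a)` (the conventions of `coordRiemann`, `covDerivUnitField` of
  `ChernTransgression.lean`), with their transformation laws under a change of basis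
  (`frameGram_basis`, …: `PᵀgP`, `Pᵀu♭`, `PᵀNP`, `transform₄ P W` for `P = e.toMatrix e'`);
* `chernVecOfFrame B u R S e = ∑ᵢ Xⁱ eᵢ`, the **Chern vector as an element of `V`**, and
  `chernVecOfFrame_eq_of_basis`: it does NOT depend on the basis (`chernVec_basisChange`), with
  its naturality under linear isomorphisms `chernVecOfFrame_map` — this is what globalises Chern's
  form `Π` on a manifold (Chern 1944, §1; Chern 1945, §1);
* `pfaffOfFrame B R e = (32 det g)⁻¹ · pfaffPair W W`, the **Pfaffian (Euler density) read in a
  frame**, `pfaffOfFrame_eq_of_basis` (basis independence, `pfaffPair_conj`), `pfaffOfFrame_map`,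
  and `pfaffPair_eq_pfaffianSumFour` (the dictionary with `pfaffianSumFour` of `EulerFormFour.lean`,
  a pure reindexing);
* the algebra of the model computation at a nondegenerate zero (Chern 1945, §2):
  `chernPair₀_eq_trace_mul_adjugate` (`∑_{σ,τ} sgn σ sgn τ X_{σ0τ0} N_{σ1τ1} N_{σ2τ2} N_{σ3τ3}
  = 6 tr(X adj N)`), `chernSum₀_eq_adjugate_mulVec` (`T₀ = 6 adj(N) u♭`) and
  `chernSum₀_sub_vecMulVec` (a rank-one correction `N ↦ N − u♭ ⊗ z` does not change `T₀`:
  two parallel rank-one slots kill a mixed discriminant, `mixedDisc_eq_zero_of_vecMulVec`).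

Everything is proved; the definitions are explicit finite expressions.

## References

* S.-S. Chern, *On the curvatura integra in a Riemannian manifold*, Ann. of Math. 46 (1945)
  674–684, §1 ((4), (9): `Φₖ`, `Π`; "intrinsic"), §2 (the index at a zero). [Chern1945]
* S.-S. Chern, *A simple intrinsic proof of the Gauss–Bonnet formula for closed Riemannian
  manifolds*, Ann. of Math. 45 (1944) 747–752, §1. [Chern1944]
* R. B. Bapat, *Mixed discriminants of positive semidefinite matrices*, Linear Algebra Appl. 126
  (1989), (1). [Bapat1989]
-/

noncomputable section

open Equiv Equiv.Perm Finset Matrix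
open Literature.LinearAlgebra.Matrix

namespace Literature.Geometry.Riemannian

/-! ### The arrays of intrinsic data in a frame -/

section Frame

variable {V : Type*} [AddCommGroup V] [Module ℝ V]

/-- The **Gram matrix** of a bilinear form in a `4`-frame, `g_{ij} = B(eᵢ, eⱼ)`. [folklore] -/
def frameGram (B : LinearMap.BilinForm ℝ V) (e : Fin 4 → V) : Matrix (Fin 4) (Fin 4) ℝ :=
  Matrix.of fun i j ↦ B (e i) (e j)

/-- The **lowered components of a vector** in a `4`-frame, `u♭_a = B(u, e_a)`. [folklore] -/
def frameCovector (B : LinearMap.BilinForm ℝ V) (u : V) (e : Fin 4 → V) : Fin 4 → ℝ :=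
  fun a ↦ B u (e a)

/-- The **lowered components of an endomorphism** in a `4`-frame, `N_{ak} = B(S e_k, e_a)` (for
`S = ∇u` these are the `(∇ₖu)ₐ` of `covDerivUnitField`). [folklore] -/
def frameEndo (B : LinearMap.BilinForm ℝ V) (S : V →ₗ[ℝ] V) (e : Fin 4 → V) :
    Matrix (Fin 4) (Fin 4) ℝ :=
  Matrix.of fun a k ↦ B (S (e k)) (e a)

/-- The **covariant components of a curvature-type trilinear map** in a `4`-frame,
`W_{ackl} = B(R(e_k, e_l) e_c, e_a)` (the convention `Rᵢⱼₖₗ = ⟨R(∂ₖ,∂ₗ)∂ⱼ, ∂ᵢ⟩` of `coordRiemann`,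
`ChernTransgression.lean`). [folklore] -/
def frameCurv (B : LinearMap.BilinForm ℝ V) (R : V →ₗ[ℝ] V →ₗ[ℝ] V →ₗ[ℝ] V) (e : Fin 4 → V) :
    Fin 4 → Fin 4 → Fin 4 → Fin 4 → ℝ :=
  fun a c k l ↦ B (R (e k) (e l) (e c)) (e a)

/-- Unfolding lemma for `frameGram`. [folklore] -/
@[simp] theorem frameGram_apply (B : LinearMap.BilinForm ℝ V) (e : Fin 4 → V) (i j : Fin 4) :
    frameGram B e i j = B (e i) (e j) := rfl

/-- Unfolding lemma for `frameCovector`. [folklore] -/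
@[simp] theorem frameCovector_apply (B : LinearMap.BilinForm ℝ V) (u : V) (e : Fin 4 → V)
    (a : Fin 4) : frameCovector B u e a = B u (e a) := rfl

/-- Unfolding lemma for `frameEndo`. [folklore] -/
@[simp] theorem frameEndo_apply (B : LinearMap.BilinForm ℝ V) (S : V →ₗ[ℝ] V) (e : Fin 4 → V)
    (a k : Fin 4) : frameEndo B S e a k = B (S (e k)) (e a) := rfl

/-- Unfolding lemma for `frameCurv`. [folklore] -/
@[simp] theorem frameCurv_apply (B : LinearMap.BilinForm ℝ V) (R : V →ₗ[ℝ] V →ₗ[ℝ] V →ₗ[ℝ] V)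
    (e : Fin 4 → V) (a c k l : Fin 4) : frameCurv B R e a c k l = B (R (e k) (e l) (e c)) (e a) :=
  rfl

/-! ### Change of basis -/

variable (B : LinearMap.BilinForm ℝ V) (u : V) (S : V →ₗ[ℝ] V) (R : V →ₗ[ℝ] V →ₗ[ℝ] V →ₗ[ℝ] V)
  (e e' : Module.Basis (Fin 4) ℝ V)

/-- The new basis in terms of the old one: `e'_a = ∑ₓ P_{xa} eₓ`, `P = e.toMatrix e'`.
[folklore] -/
theorem basis_eq_sum_toMatrix_smul (a : Fin 4) : e' a = ∑ x, e.toMatrix e' x a • e x :=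
  (e.sum_toMatrix_smul_self e' a).symm

/-- The change-of-basis matrix between two bases has nonzero determinant. [folklore] -/
theorem det_toMatrix_ne_zero : (e.toMatrix e').det ≠ 0 := by
  intro h
  have h1 := congrArg Matrix.det (e.toMatrix_mul_toMatrix_flip e')
  rw [Matrix.det_mul, h, zero_mul, Matrix.det_one] at h1
  exact zero_ne_one h1

/-- The inverse of the change-of-basis matrix is the reverse change of basis. [folklore] -/
theorem toMatrix_inv : (e.toMatrix e')⁻¹ = e'.toMatrix e :=
  Matrix.inv_eq_right_inv (e.toMatrix_mul_toMatrix_flip e')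

/-- **The Gram matrix is a form of weight `PᵀgP`.** [folklore] -/
theorem frameGram_basis :
    frameGram B e' = (e.toMatrix e')ᵀ * frameGram B e * e.toMatrix e' := by
  ext i j
  simp only [frameGram_apply, Matrix.mul_apply, Matrix.transpose_apply, Finset.sum_mul]
  conv_lhs => rw [basis_eq_sum_toMatrix_smul e e' i, basis_eq_sum_toMatrix_smul e e' j]
  simp only [map_sum, map_smul, LinearMap.sum_apply, LinearMap.smul_apply, smul_eq_mul,
    Finset.mul_sum]
  refine Finset.sum_congr rfl fun x _ ↦ Finset.sum_congr rfl fun y _ ↦ ?_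
  ring

/-- **A covector transforms by `Pᵀ`.** [folklore] -/
theorem frameCovector_basis :
    frameCovector B u e' = (e.toMatrix e')ᵀ *ᵥ frameCovector B u e := by
  ext a
  simp only [frameCovector_apply, Matrix.mulVec, dotProduct, Matrix.transpose_apply]
  conv_lhs => rw [basis_eq_sum_toMatrix_smul e e' a]
  simp only [map_sum, map_smul, smul_eq_mul]

/-- **The lowered endomorphism transforms by `PᵀNP`.** [folklore] -/
theorem frameEndo_basis :
    frameEndo B S e' = (e.toMatrix e')ᵀ * frameEndo B S e * e.toMatrix e' := by
  ext a k
  simp only [frameEndo_apply, Matrix.mul_apply, Matrix.transpose_apply, Finset.sum_mul]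
  conv_lhs => rw [basis_eq_sum_toMatrix_smul e e' k, basis_eq_sum_toMatrix_smul e e' a]
  simp only [map_sum, map_smul, LinearMap.sum_apply, LinearMap.smul_apply, smul_eq_mul,
    Finset.mul_sum]
  rw [Finset.sum_comm]
  refine Finset.sum_congr rfl fun x _ ↦ Finset.sum_congr rfl fun y _ ↦ ?_
  ring

/-- **The covariant curvature array transforms by `transform₄ P`.** [folklore] -/
theorem frameCurv_basis :
    frameCurv B R e' = transform₄ (e.toMatrix e') (frameCurv B R e) := by
  funext a c k l
  rw [transform₄_apply, frameCurv_apply]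
  conv_lhs => rw [basis_eq_sum_toMatrix_smul e e' k, basis_eq_sum_toMatrix_smul e e' l,
    basis_eq_sum_toMatrix_smul e e' c, basis_eq_sum_toMatrix_smul e e' a]
  simp only [map_sum, map_smul, LinearMap.sum_apply, LinearMap.smul_apply, smul_eq_mul,
    frameCurv_apply, Finset.mul_sum]
  refine Finset.sum_congr rfl fun xa _ ↦ Finset.sum_congr rfl fun xc _ ↦ ?_
  rw [Finset.sum_comm]
  refine Finset.sum_congr rfl fun xk _ ↦ Finset.sum_congr rfl fun xl _ ↦ ?_
  ring

/-! ### The Chern vector of intrinsic data -/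

/-- **The Chern vector of the data `(B, u, R, S)` as an element of `V`**: `∑ᵢ Xⁱ eᵢ` with
`X = chernVec g u♭ W N` the Chern vector (`ChernTransgressionPointwise.lean`) of the arrays of the
data in the basis `e`. It does not depend on `e` (`chernVecOfFrame_eq_of_basis`). For the metric,
unit field, curvature and `∇u` of a Riemannian `4`-manifold at a point this is the vector field
`X` with `ι_X dV = u^*Π`, `Π` Chern's transgression form (Chern 1945, (9)). [cite: Chern1945, (9)] -/
def chernVecOfFrame (e : Module.Basis (Fin 4) ℝ V) : V :=
  ∑ i, chernVec (frameGram B e) (frameCovector B u e) (frameCurv B R e) (frameEndo B S e) i • e i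

/-- Unfolding lemma for `chernVecOfFrame`. [cite: Chern1945, (9)] -/
theorem chernVecOfFrame_def (e : Module.Basis (Fin 4) ℝ V) :
    chernVecOfFrame B u S R e = ∑ i, chernVec (frameGram B e) (frameCovector B u e)
      (frameCurv B R e) (frameEndo B S e) i • e i := rfl

/-- **The Chern vector is intrinsic** (Chern 1945, §1: "the form `Π` is intrinsic"): the vector
`∑ᵢ Xⁱ eᵢ` is the same in every basis (`chernVec_basisChange`: the components transform
contravariantly). [cite: Chern1945, §1] -/
theorem chernVecOfFrame_eq_of_basis : chernVecOfFrame B u S R e' = chernVecOfFrame B u S R e := by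
  have hPd : (e.toMatrix e').det ≠ 0 := det_toMatrix_ne_zero e e'
  rw [chernVecOfFrame_def, chernVecOfFrame_def, frameGram_basis B e e', frameCovector_basis B u e e',
    frameEndo_basis B S e e', frameCurv_basis B R e e']
  simp only [chernVec_basisChange hPd, Finset.sum_smul, toMatrix_inv]
  rw [Finset.sum_comm]
  refine Finset.sum_congr rfl fun j _ ↦ ?_
  simp only [mul_smul]
  rw [show (∑ x, e'.toMatrix e x j • chernVec (frameGram B e) (frameCovector B u e) (frameCurv B R e)
      (frameEndo B S e) j • e' x) = chernVec (frameGram B e) (frameCovector B u e) (frameCurv B R e)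
      (frameEndo B S e) j • ∑ x, e'.toMatrix e x j • e' x from by
    rw [Finset.smul_sum]; exact Finset.sum_congr rfl fun x _ ↦ smul_comm _ _ _,
    e'.sum_toMatrix_smul_self e j]

variable {W : Type*} [AddCommGroup W] [Module ℝ W]

/-- **Naturality of the Chern vector under linear isomorphisms**: transporting the data along
`D : V ≃ W` (`B'(v, w) = B(D⁻¹v, D⁻¹w)`, `u' = D u`, `S' = D S D⁻¹`, `R'(X,Y)Z = D R(D⁻¹X, D⁻¹Y) D⁻¹Z`)
transports the Chern vector: `X' = D X`, in any bases. [cite: Chern1945, §1] -/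
theorem chernVecOfFrame_map (D : V ≃ₗ[ℝ] W) (B' : LinearMap.BilinForm ℝ W)
    (hB : ∀ v w, B' v w = B (D.symm v) (D.symm w)) (S' : W →ₗ[ℝ] W)
    (hS : ∀ w, S' w = D (S (D.symm w))) (R' : W →ₗ[ℝ] W →ₗ[ℝ] W →ₗ[ℝ] W)
    (hR : ∀ X Y Z, R' X Y Z = D (R (D.symm X) (D.symm Y) (D.symm Z)))
    (f : Module.Basis (Fin 4) ℝ W) :
    chernVecOfFrame B' (D u) S' R' f = D (chernVecOfFrame B u S R e) := by
  rw [chernVecOfFrame_eq_of_basis B' (D u) S' R' (e.map D) f, chernVecOfFrame_def,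
    chernVecOfFrame_def, map_sum]
  have hG : frameGram B' (e.map D) = frameGram B e := by
    ext i j; simp [hB]
  have hu : frameCovector B' (D u) (e.map D) = frameCovector B u e := by
    ext a; simp [hB]
  have hN : frameEndo B' S' (e.map D) = frameEndo B S e := by
    ext a k; simp [hB, hS]
  have hW : frameCurv B' R' (e.map D) = frameCurv B R e := by
    funext a c k l; simp [hB, hR]
  simp only [hG, hu, hN, hW, Module.Basis.map_apply, map_smul]

/-! ### The Pfaffian (Euler density) of intrinsic data -/

/-- **The Pfaffian of the data `(B, R)` read in a `4`-frame**: `(32 det g)⁻¹ · pfaffPair W W` with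
`g` the Gram matrix and `W` the covariant curvature array of the frame — the Euler density
`E/√(det g)` of `ChernTransgression.lean` (Chern 1945, (10): `Pf(Ω) = E dx`,
`E = (32 √det g)⁻¹ ∑∑ sgn sgn R R`, `eulerDensity_four`) as a SCALAR. Independent of the frame
(`pfaffOfFrame_eq_of_basis`). [cite: Chern1945, (10)] -/
def pfaffOfFrame (B : LinearMap.BilinForm ℝ V) (R : V →ₗ[ℝ] V →ₗ[ℝ] V →ₗ[ℝ] V) (e : Fin 4 → V) :
    ℝ :=
  (32 * (frameGram B e).det)⁻¹ * pfaffPair (frameCurv B R e) (frameCurv B R e)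

/-- Unfolding lemma for `pfaffOfFrame`. [cite: Chern1945, (10)] -/
theorem pfaffOfFrame_def (e : Fin 4 → V) : pfaffOfFrame B R e =
    (32 * (frameGram B e).det)⁻¹ * pfaffPair (frameCurv B R e) (frameCurv B R e) := rfl

/-- **The Pfaffian scalar is intrinsic**: `(32 det g)⁻¹ pfaffPair W W` is the same in every basis
(`pfaffPair_conj`: the pairing has weight `(det P)²`, as has `det g`). [cite: Chern1945, (10)] -/
theorem pfaffOfFrame_eq_of_basis : pfaffOfFrame B R e' = pfaffOfFrame B R e := by
  set P := e.toMatrix e' with hP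
  have hPd : P.det ≠ 0 := det_toMatrix_ne_zero e e'
  rw [pfaffOfFrame_def, pfaffOfFrame_def, frameGram_basis B e e', frameCurv_basis B R e e']
  simp only [← hP, pfaffPair_conj, Matrix.det_mul, Matrix.det_transpose]
  have hP2 : P.det ^ 2 ≠ 0 := pow_ne_zero 2 hPd
  by_cases hg : (frameGram B e).det = 0
  · simp [hg]
  · field_simp

omit [Module ℝ W] in
/-- **Naturality of the Pfaffian scalar under linear isomorphisms.** [cite: Chern1945, (10)] -/
theorem pfaffOfFrame_map [Module ℝ W] (D : V ≃ₗ[ℝ] W) (B' : LinearMap.BilinForm ℝ W)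
    (hB : ∀ v w, B' v w = B (D.symm v) (D.symm w)) (R' : W →ₗ[ℝ] W →ₗ[ℝ] W →ₗ[ℝ] W)
    (hR : ∀ X Y Z, R' X Y Z = D (R (D.symm X) (D.symm Y) (D.symm Z)))
    (f : Module.Basis (Fin 4) ℝ W) :
    pfaffOfFrame B' R' f = pfaffOfFrame B R e := by
  rw [pfaffOfFrame_eq_of_basis B' R' (e.map D) f, pfaffOfFrame_def, pfaffOfFrame_def]
  have hG : frameGram B' (e.map D) = frameGram B e := by
    ext i j; simp [hB]
  have hW : frameCurv B' R' (e.map D) = frameCurv B R e := by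
    funext a c k l; simp [hB, hR]
  rw [hG, hW]

end Frame

/-! ### Dictionary `pfaffPair` / `pfaffianSumFour` -/

/-- **`pfaffPair W W = pfaffianSumFour F` for `W_{ackl} = F_{klca}`**: the double alternating
curvature sum of `ChernTransgression.lean` (convention `Rᵢⱼₖₗ = Rm(∂ₖ,∂ₗ,∂ⱼ,∂ᵢ)`) against the
`pfaffianSumFour` of `EulerFormFour.lean` (convention `Rm(eᵢ,eⱼ,eₖ,eₗ)`): a pure reindexing
(exchange `σ ↔ τ`, then `τ ↦ τ ∘ (0 1)(2 3)`, an even permutation); no symmetry of `F` is used.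
[cite: Chern1945, (10)] -/
theorem pfaffPair_eq_pfaffianSumFour (F : Fin 4 → Fin 4 → Fin 4 → Fin 4 → ℝ) :
    pfaffPair (fun a c k l ↦ F k l c a) (fun a c k l ↦ F k l c a) = pfaffianSumFour F := by
  rw [pfaffPair, pfaffianSumFour, Finset.sum_comm]
  refine Finset.sum_congr rfl fun σ _ ↦ ?_
  set c : Perm (Fin 4) := Equiv.swap 0 1 * Equiv.swap 2 3 with hc
  have hsc : Equiv.Perm.sign c = 1 := by rw [hc]; decide
  rw [← Equiv.sum_comp (Equiv.mulRight c)]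
  refine Finset.sum_congr rfl fun τ _ ↦ ?_
  have h0 : (τ * c) 0 = τ 1 := by simp [hc, Equiv.swap_apply_def]
  have h1 : (τ * c) 1 = τ 0 := by simp [hc, Equiv.swap_apply_def]
  have h2 : (τ * c) 2 = τ 3 := by simp [hc, Equiv.swap_apply_def]
  have h3 : (τ * c) 3 = τ 2 := by simp [hc, Equiv.swap_apply_def]
  simp only [Equiv.coe_mulRight, h0, h1, h2, h3, Equiv.Perm.sign_mul, hsc, mul_one]
  ring

/-! ### The algebra of the model at a nondegenerate zero -/

section Adjugate

variable {R : Type*} [CommRing R]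

/-- A sum over `S₄` of a function of `σ 0` only: `∑_σ f(σ 0) = 6 ∑ₐ f a` (row expansion;
`3! = 6` permutations with prescribed `σ 0`). [folklore] -/
theorem sum_perm_apply_zero (f : Fin 4 → R) :
    ∑ σ : Perm (Fin 4), f (σ 0) = 6 * ∑ a, f a := by
  rw [sum_perm_fin_succ_eq_sum_decomposeFin, Finset.mul_sum]
  refine Finset.sum_congr rfl fun p _ ↦ ?_
  simp only [Equiv.Perm.decomposeFin_symm_apply_zero, Finset.sum_const, Finset.card_univ,
    Fintype.card_perm, Fintype.card_fin, nsmul_eq_mul]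
  norm_num [Nat.factorial]

/-- **Chern's `k = 0` pairing through the adjugate**:
`∑_{σ,τ} sgn σ sgn τ X_{σ0τ0} N_{σ1τ1} N_{σ2τ2} N_{σ3τ3} = 6 tr(X · adj N)` (for each `σ` the
`τ`-sum is the determinant of `N` with row `σ 0` replaced by the row `σ 0` of `X`, i.e.
`∑_b X_{ab} adj(N)_{ba}` by Cramer's rule; there are `3!` permutations with given `σ 0`).
[cite: Chern1945, (4)] -/
theorem chernPair₀_eq_trace_mul_adjugate (X N : Matrix (Fin 4) (Fin 4) R) :
    chernPair₀ X N = 6 * Matrix.trace (X * adjugate N) := by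
  rw [chernPair₀, mixedDisc_def]
  -- the `τ`-sum, for fixed `σ`
  have hτ : ∀ σ : Perm (Fin 4), (∑ τ : Perm (Fin 4),
      ((sign σ : ℤ) : R) * ((sign τ : ℤ) : R) * ∏ s, (![X, N, N, N] s) (σ s) (τ s)) =
      (N.updateRow (σ 0) (X (σ 0))).det := by
    intro σ
    set Bσ := N.updateRow (σ 0) (X (σ 0)) with hBσ
    have hprod : ∀ τ : Perm (Fin 4), (∏ s, (![X, N, N, N] s) (σ s) (τ s)) =
        ∏ s, Bσ (σ s) (τ s) := by
      intro τ
      refine Finset.prod_congr rfl fun s _ ↦ ?_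
      by_cases hs : s = 0
      · subst hs
        simp [hBσ]
      · have hne : σ s ≠ σ 0 := fun h ↦ hs (σ.injective h)
        rw [hBσ, Matrix.updateRow_ne hne]
        fin_cases s
        · exact absurd rfl hs
        all_goals rfl
    simp only [hprod, mul_assoc, ← Finset.mul_sum]
    rw [sum_sign_mul_prod_apply_eq_det_submatrix Bσ σ, det_submatrix_perm, ← mul_assoc,
      ← Int.cast_mul, ← Units.val_mul, Int.units_mul_self, Units.val_one, Int.cast_one, one_mul]
  simp only [hτ]
  -- Cramer: `det (N.updateRow a (X a)) = ∑_b X_{ab} adj(N)_{ba} = (X * adj N)_{aa}`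
  have hcr : ∀ a : Fin 4, (N.updateRow a (X a)).det = (X * adjugate N) a a := by
    intro a
    rw [← Matrix.cramer_transpose_apply, Matrix.cramer_eq_adjugate_mulVec, ← Matrix.adjugate_transpose,
      Matrix.mulVec, dotProduct, Matrix.mul_apply]
    refine Finset.sum_congr rfl fun b _ ↦ ?_
    rw [Matrix.transpose_apply, mul_comm]
  rw [sum_perm_apply_zero (fun a ↦ (N.updateRow a (X a)).det), Matrix.trace]
  simp only [hcr, Matrix.diag_apply]

/-- **Chern's sum `T₀` through the adjugate**: `T₀(i) = 6 (adj(N) u♭)ᵢ`. [cite: Chern1945, (4)] -/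
theorem chernSum₀_eq_adjugate_mulVec (uL : Fin 4 → R) (N : Matrix (Fin 4) (Fin 4) R) (i : Fin 4) :
    chernSum₀ uL N i = 6 * (adjugate N *ᵥ uL) i := by
  rw [chernSum₀, chernPair₀_eq_trace_mul_adjugate, Matrix.trace, Matrix.mulVec, dotProduct]
  congr 1
  simp only [Matrix.diag_apply, Matrix.mul_apply, Matrix.vecMulVec_apply, Pi.single_apply, mul_ite,
    mul_one, mul_zero, ite_mul, zero_mul, Finset.sum_ite_eq', Finset.mem_univ, if_true]
  refine Finset.sum_congr rfl fun a _ ↦ ?_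
  ring

/-- **A rank-one correction along `u♭` does not change `T₀`**:
`T₀(u♭, N − u♭ ⊗ z) = T₀(u♭, N)` — expanding the three `N`-slots, every term containing the
rank-one matrix `u♭ ⊗ z` has two slots with the same left vector `u♭` (slot `0` is `u♭ ⊗ eᵢ`) and
vanishes (`mixedDisc_eq_zero_of_vecMulVec`). This is why, at a nondegenerate zero, the principal
part of Chern's field is computed from the linear part of the field alone (Chern 1945, §2).
[cite: Chern1945, §2] -/
theorem chernSum₀_sub_vecMulVec (uL z : Fin 4 → R) (C : Matrix (Fin 4) (Fin 4) R) (i : Fin 4) :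
    chernSum₀ uL (C - vecMulVec uL z) i = chernSum₀ uL C i := by
  set A := vecMulVec uL (Pi.single i (1 : R)) with hA
  -- kill a family with slot `0 = A` and another slot `= uL ⊗ z`
  have hkill : ∀ (M : Fin 4 → Matrix (Fin 4) (Fin 4) R) (s : Fin 4), s ≠ 0 → M 0 = A →
      M s = vecMulVec uL z → mixedDisc M = 0 := fun M s hs h0 h1 ↦
    mixedDisc_eq_zero_of_vecMulVec M (Ne.symm hs) uL (Pi.single i 1) z h0 h1
  -- expand slot by slot
  have hslot : ∀ (M : Fin 4 → Matrix (Fin 4) (Fin 4) R) (s : Fin 4), s ≠ 0 → M 0 = A →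
      mixedDisc (Function.update M s (C - vecMulVec uL z)) = mixedDisc (Function.update M s C) := by
    intro M s hs h0
    rw [sub_eq_add_neg, mixedDisc_update_add, ← neg_one_smul R (vecMulVec uL z),
      mixedDisc_update_smul]
    have h := hkill (Function.update M s (vecMulVec uL z)) s hs
      (by rw [Function.update_of_ne (Ne.symm hs)]; exact h0) (Function.update_self _ _ _)
    rw [h, mul_zero, add_zero]
  rw [chernSum₀, chernSum₀, chernPair₀, chernPair₀]
  have e1 : ![A, C - vecMulVec uL z, C - vecMulVec uL z, C - vecMulVec uL z] =
      Function.update ![A, C, C - vecMulVec uL z, C - vecMulVec uL z] 1 (C - vecMulVec uL z) := by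
    funext s; fin_cases s <;> rfl
  have e1' : Function.update ![A, C, C - vecMulVec uL z, C - vecMulVec uL z] 1 C =
      ![A, C, C - vecMulVec uL z, C - vecMulVec uL z] := by
    funext s; fin_cases s <;> rfl
  have e2 : ![A, C, C - vecMulVec uL z, C - vecMulVec uL z] =
      Function.update ![A, C, C, C - vecMulVec uL z] 2 (C - vecMulVec uL z) := by
    funext s; fin_cases s <;> rfl
  have e2' : Function.update ![A, C, C, C - vecMulVec uL z] 2 C =
      ![A, C, C, C - vecMulVec uL z] := by
    funext s; fin_cases s <;> rfl
  have e3 : ![A, C, C, C - vecMulVec uL z] = Function.update ![A, C, C, C] 3 (C - vecMulVec uL z) := by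
    funext s; fin_cases s <;> rfl
  have e3' : Function.update ![A, C, C, C] 3 C = ![A, C, C, C] := by
    funext s; fin_cases s <;> rfl
  rw [e1, hslot _ 1 (by decide) rfl, e1', e2, hslot _ 2 (by decide) rfl, e2', e3,
    hslot _ 3 (by decide) rfl, e3']

/-- **`T₀` is cubic in `N`**: `T₀(u♭, c N) = c³ T₀(u♭, N)` (`adj(cN) = c³ adj N` for `4 × 4`
matrices). [cite: Chern1945, (4)] -/
theorem chernSum₀_smul (uL : Fin 4 → R) (c : R) (N : Matrix (Fin 4) (Fin 4) R) (i : Fin 4) :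
    chernSum₀ uL (c • N) i = c ^ 3 * chernSum₀ uL N i := by
  rw [chernSum₀_eq_adjugate_mulVec, chernSum₀_eq_adjugate_mulVec, Matrix.adjugate_smul,
    Fintype.card_fin, Matrix.smul_mulVec, Pi.smul_apply, smul_eq_mul]
  norm_num
  ring

/-- `T₁` vanishes when the curvature array does (flat model). [cite: Chern1945, (4)] -/
theorem chernSum₁_zero (uL : Fin 4 → R) (N : Matrix (Fin 4) (Fin 4) R) (i : Fin 4) :
    chernSum₁ uL (0 : Fin 4 → Fin 4 → Fin 4 → Fin 4 → R) N i = 0 := by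
  simp [chernSum₁, chernPair₁]

/-- **The model at a nondegenerate zero** (Chern 1945, §2): for the constant metric `g`, the
linear field `L y` and `ρ = r⁻¹` its length, the lowered unit field is `u♭ = r · g L y` and its
lowered differential is `N = r (gL − u♭ ⊗ z)` (`z_k = g(L e_k, u)`); then
`T₀(u♭, N) = 6 r⁴ det g · det L · y` — the rank-one part drops out (`chernSum₀_sub_vecMulVec`),
`T₀(u♭, gL) = 6 adj(gL) u♭` and `adj(gL) gL y = det(gL) y`. With the factor `−(det g)⁻¹/3` of
`chernVec` this is the radial principal part `−2 det L · y/ρ⁴` of Chern's field, whose flux through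
small spheres is `−(2π)² sign det L` (`IndexFluxLimitFour.lean`). [cite: Chern1945, §2, (14)–(16)] -/
theorem chernSum₀_model (g L : Matrix (Fin 4) (Fin 4) R) (y z : Fin 4 → R) (r : R) (i : Fin 4) :
    chernSum₀ (r • (g * L) *ᵥ y) (r • (g * L - vecMulVec (r • (g * L) *ᵥ y) z)) i =
      6 * r ^ 4 * g.det * L.det * y i := by
  rw [chernSum₀_smul, chernSum₀_sub_vecMulVec, chernSum₀_eq_adjugate_mulVec, Matrix.mulVec_smul,
    Matrix.mulVec_mulVec, Matrix.adjugate_mul, Pi.smul_apply, smul_eq_mul, Matrix.smul_mulVec,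
    Matrix.one_mulVec, Pi.smul_apply, smul_eq_mul, Matrix.det_mul]
  ring

end Adjugate

end Literature.Geometry.Riemannian

end
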